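import Literature.NumberTheory.EllipticCurves.KrizLi2019.TwoPartBSDTwists
import Literature.NumberTheory.EllipticCurves.Zhai2021.TwoAdicLowerBoundTwists
import HarnessLib

/-!
# Kriz–Li 2019 (FMS 7, e15), §6 Table 1 («Assumption (★) for rank one curves») — the eight SQUARE-FREE-conductor rows GOOD at `2` beyond the prime
# ones: `123a1`, `123b1`, `141a1`, `141d1`, `219a1`, `219b1` (`d_K = −23`) and `155a1`, `155c1` (`d_K = −79`) AS PRINTED (statement-only named facts; the
# per-curve inputs of Thm 5.1 (2) = `thm112_bsdTwo_twist`; all with `c₂(E) = 1`)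

HONEST FRAMING (cell `bsd-f1-sign2`, seat `bsd-line-gk2-p2` g34, crux U₂ `MinimalTwinBSDTwo` stmt-BirchSwinnertonDyer-22985, LINE 23 «twin_swap»;
2026-08-31): eight PUBLISHED per-curve computational assertions (check-marks in a table of a refereed paper) vendored as named `Prop`s — nothing asserted,
nothing discharged (D-0014) — with a locator into the held source; same shape as `table1_row92b1` / `table1_row37a1` / `table1_row101a1` (optimal
parametrisation datum transcribed because Example 6.2 searches «rank one OPTIMAL elliptic curves»; all eight curves are GOOD at `2`, so consumers of Thm 5.1 (2)
may ignore the optimality conjunct).  With the earlier files this completes the transcription of ALL THIRTEEN rank-one rows of Table 1 that are semistable,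
good at `2` and have `c₂` odd (`37a1, 43a1, 101a1, 123a1, 123b1, 131a1, 141a1, 141d1, 155a1, 155c1, 163a1, 219a1, 219b1`); not transcribed here: `88a1`
(`c₂ = 4`), `91a1/91b1` (`d_K = −55` composite), `92b1` (own file), the additive-at-`2` rows `124a1, 148a1, 172a1, 196a1` and `189a1/b1` (additive at `3`),
`243a1` (CM, own file) and the rows without ✓.  The Weierstrass models are Cremona's reduced minimal models as recorded in the tree's kit census
`Literature/NumberTheory/EllipticCurves/HypothesisSweep/RecordsN000116to000177.lean` / `…N000178to000233.lean` (fields `label`, `ainvs`, `conductor`).  For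
these rows the companion `E^{(d_K)}` has conductor `d_K²·N > 5000`: the consumer (`…KrizLiAnchorWall(SS).lean`) takes the companion's `BSD(2)` from the
rank-zero WALL.  Nothing is booked here; BSD is not proved by any of this.

Source. D. Kriz, C. Li, *Goldfeld's conjecture and congruences between Heegner points*, Forum Math. Sigma **7** (2019), e15, doi:10.1017/fms.2019.9
[KrizLi2019] = arXiv:1606.03172 (§§1–6). Texts read: the held chunk text `paper:doi-10-1017-fms-2019-9` (p0017 L21: Example 6.2), which DROPS the table body;
the table itself was read in the arXiv v3 source `Congruence.tex` (copy at `run/shared/lean/pub/bsd-print-cf2/lit/krizli2019/arXiv-1606.03172v3-Congruence.tex`),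
ll. 964–1017 (`\label{tab:1}`, Example 6.2), rows at lines 978, 979, 982, 983, 989, 990, 1007, 1008.

## The printed statement (verbatim)

* Example 6.2 (tex l. 965): "We search for rank one optimal elliptic curves with `E(ℚ)[2] = 0` satisfying these two necessary conditions. There are 38
  such curves of conductor `≤ 300`. For each curve, we choose `K` with smallest `|d_K|` satisfying the Heegner hypothesis for `N` and such that `2` is
  split in `K`. Then 31 out of 38 curves satisfy (★). See Table 1. … If `c₂(E)` is further odd (true for 23 out of 31), then the application to BSD(2)
  (Theorem 5.1) also applies."
* Table 1, caption "Assumption (★) for rank one curves", header `E | d_K | c₂(E) | ★`, the rows transcribed here (tex ll. 978–1008):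
  "`123a1 & -23 & 1 & ✓`", "`123b1 & -23 & 1 & ✓`", "`141a1 & -23 & 1 & ✓`", "`141d1 & -23 & 1 & ✓`", "`155a1 & -79 & 1 & ✓`", "`155c1 & -79 & 1 & ✓`",
  "`219a1 & -23 & 1 & ✓`", "`219b1 & -23 & 1 & ✓`".

## Transcription (tree dictionary of `KrizLi2019/TwoPartBSDTwists.lean`)

Models (Cremona, from the tree's census records): `123a1 = [0,1,1,−10,10]`, `123b1 = [0,−1,1,1,−1]`, `141a1 = [0,1,1,−12,2]`, `141d1 = [0,−1,1,−1,0]`,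
`155a1 = [0,−1,1,10,6]`, `155c1 = [0,−1,1,−1,1]`, `219a1 = [0,−1,1,−6,8]`, `219b1 = [0,1,1,3,2]`.  "`K = ℚ(√d_K)`" = any `K` with `IsImaginaryQuadratic K` and
`NumberField.discr K = d_K`.  "Optimal curve with its parametrisation" = a datum `Dt : ModularParametrizationData E N` at the conductor level (`NeZero` witness
packed) with `Zhai2021.IsOptimalDatum E Dt`; "(★) holds" = a Heegner datum `H`, an embedding `ι`, a point `P ∈ E(K)` mapping to `heegnerPointComplex Dt H`, and
`j : K →ₐ[ℚ] ℚ₂` with `AssumptionStar E Dt K P j`.  Global minimality of the printed model is a binder `[IsGloballyMinimal]`.  "Rank one", "`E(ℚ)[2] = 0`",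
"`c₂(E) = 1`" are NOT transcribed (kernel-side in the consumer).  Nothing weaker or stronger is transcribed; no `_holds` is expected.  Status: PUB (refereed);
per-curve computational TABLE entries, flag word for the referee: TABLE.

## References
* [KrizLi2019] §6 Example 6.2 and Table 1 (FMS chunk p0017 L21; arXiv:1606.03172v3 `Congruence.tex` ll. 965, 978–1008); Assumption (★) (arXiv p0003 L45–L48).
* [CremonaAlgorithms1997] Table 1 (curves 123A1, 123B1, 141A1, 141D1, 155A1, 155C1, 219A1, 219B1).
* [Zhai2021BSDExactFormulaTwists] §1 (the optimality predicate `IsOptimalDatum`).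
-/

noncomputable section

open scoped Classical

open NumberField WeierstrassCurve Literature.NumberTheory.EllipticCurves
  Literature.NumberTheory.EllipticCurves.ModularForms

namespace Literature.NumberTheory.EllipticCurves.KrizLi2019

/-- **Kriz–Li 2019, §6 Table 1, row `123a1`** (`123a1 | d_K = -23 | c₂(E) = 1 | ★ ✓`; Example 6.2): for every imaginary quadratic field `K` of discriminant
`-23`, the optimal curve `123a1` on its (globally minimal) model `[0,1,1,-10,10]` (`y² + y = x³ + x² − 10x + 10`; `Δ = −3⁵·41`, `N = 3·41`) admits an OPTIMAL modular
parametrisation datum `Dt` at level `N(E)`, a Heegner datum `H` of discriminant `d_K` and level `N(E)`, an embedding `ι : K → ℂ`, a point `P ∈ E(K)` mapping to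
`heegnerPointComplex Dt H`, and `j : K → ℚ₂` with `AssumptionStar E Dt K P j`.  Statement only; TABLE entry; no `_holds` expected.
[cite: KrizLi2019, §6 Table 1 (row 123a1) and Example 6.2 (FMS 7 (2019) e15, chunk p0017 L21; arXiv:1606.03172v3 Congruence.tex ll. 965, 978)] -/
def table1_row123a1 : Prop :=
  ∀ [(⟨0, 1, 1, -10, 10⟩ : WeierstrassCurve ℚ).IsGloballyMinimal]
    (K : Type) [Field K] [NumberField K], IsImaginaryQuadratic K → NumberField.discr K = -23 →
    ∃ (_ : NeZero ((⟨0, 1, 1, -10, 10⟩ : WeierstrassCurve ℚ).conductorNorm ℤ))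
      (Dt : ModularParametrizationData (⟨0, 1, 1, -10, 10⟩ : WeierstrassCurve ℚ) ((⟨0, 1, 1, -10, 10⟩ : WeierstrassCurve ℚ).conductorNorm ℤ))
      (H : HeegnerDatum ((⟨0, 1, 1, -10, 10⟩ : WeierstrassCurve ℚ).conductorNorm ℤ) (NumberField.discr K))
      (ι : K →+* ℂ) (P : ((⟨0, 1, 1, -10, 10⟩ : WeierstrassCurve ℚ).baseChange K).toAffine.Point) (j : K →ₐ[ℚ] ℚ_[2]),
      Zhai2021.IsOptimalDatum (⟨0, 1, 1, -10, 10⟩ : WeierstrassCurve ℚ) Dt ∧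
        WeierstrassCurve.Affine.Point.map ι.toRatAlgHom P = heegnerPointComplex Dt H ∧
          AssumptionStar (⟨0, 1, 1, -10, 10⟩ : WeierstrassCurve ℚ) Dt K P j

/-- **Kriz–Li 2019, §6 Table 1, row `123b1`** (`123b1 | d_K = -23 | c₂(E) = 1 | ★ ✓`; Example 6.2): for every imaginary quadratic field `K` of discriminant
`-23`, the optimal curve `123b1` on its (globally minimal) model `[0,-1,1,1,-1]` (`y² + y = x³ − x² + x − 1`; `Δ = −3·41`, `N = 3·41`) admits an OPTIMAL modular
parametrisation datum `Dt` at level `N(E)`, a Heegner datum `H` of discriminant `d_K` and level `N(E)`, an embedding `ι : K → ℂ`, a point `P ∈ E(K)` mapping to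
`heegnerPointComplex Dt H`, and `j : K → ℚ₂` with `AssumptionStar E Dt K P j`.  Statement only; TABLE entry; no `_holds` expected.
[cite: KrizLi2019, §6 Table 1 (row 123b1) and Example 6.2 (FMS 7 (2019) e15, chunk p0017 L21; arXiv:1606.03172v3 Congruence.tex ll. 965, 979)] -/
def table1_row123b1 : Prop :=
  ∀ [(⟨0, -1, 1, 1, -1⟩ : WeierstrassCurve ℚ).IsGloballyMinimal]
    (K : Type) [Field K] [NumberField K], IsImaginaryQuadratic K → NumberField.discr K = -23 →
    ∃ (_ : NeZero ((⟨0, -1, 1, 1, -1⟩ : WeierstrassCurve ℚ).conductorNorm ℤ))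
      (Dt : ModularParametrizationData (⟨0, -1, 1, 1, -1⟩ : WeierstrassCurve ℚ) ((⟨0, -1, 1, 1, -1⟩ : WeierstrassCurve ℚ).conductorNorm ℤ))
      (H : HeegnerDatum ((⟨0, -1, 1, 1, -1⟩ : WeierstrassCurve ℚ).conductorNorm ℤ) (NumberField.discr K))
      (ι : K →+* ℂ) (P : ((⟨0, -1, 1, 1, -1⟩ : WeierstrassCurve ℚ).baseChange K).toAffine.Point) (j : K →ₐ[ℚ] ℚ_[2]),
      Zhai2021.IsOptimalDatum (⟨0, -1, 1, 1, -1⟩ : WeierstrassCurve ℚ) Dt ∧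
        WeierstrassCurve.Affine.Point.map ι.toRatAlgHom P = heegnerPointComplex Dt H ∧
          AssumptionStar (⟨0, -1, 1, 1, -1⟩ : WeierstrassCurve ℚ) Dt K P j

/-- **Kriz–Li 2019, §6 Table 1, row `141a1`** (`141a1 | d_K = -23 | c₂(E) = 1 | ★ ✓`; Example 6.2): for every imaginary quadratic field `K` of discriminant
`-23`, the optimal curve `141a1` on its (globally minimal) model `[0,1,1,-12,2]` (`y² + y = x³ + x² − 12x + 2`; `Δ = 3⁷·47`, `N = 3·47`) admits an OPTIMAL modular
parametrisation datum `Dt` at level `N(E)`, a Heegner datum `H` of discriminant `d_K` and level `N(E)`, an embedding `ι : K → ℂ`, a point `P ∈ E(K)` mapping to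
`heegnerPointComplex Dt H`, and `j : K → ℚ₂` with `AssumptionStar E Dt K P j`.  Statement only; TABLE entry; no `_holds` expected.
[cite: KrizLi2019, §6 Table 1 (row 141a1) and Example 6.2 (FMS 7 (2019) e15, chunk p0017 L21; arXiv:1606.03172v3 Congruence.tex ll. 965, 982)] -/
def table1_row141a1 : Prop :=
  ∀ [(⟨0, 1, 1, -12, 2⟩ : WeierstrassCurve ℚ).IsGloballyMinimal]
    (K : Type) [Field K] [NumberField K], IsImaginaryQuadratic K → NumberField.discr K = -23 →
    ∃ (_ : NeZero ((⟨0, 1, 1, -12, 2⟩ : WeierstrassCurve ℚ).conductorNorm ℤ))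
      (Dt : ModularParametrizationData (⟨0, 1, 1, -12, 2⟩ : WeierstrassCurve ℚ) ((⟨0, 1, 1, -12, 2⟩ : WeierstrassCurve ℚ).conductorNorm ℤ))
      (H : HeegnerDatum ((⟨0, 1, 1, -12, 2⟩ : WeierstrassCurve ℚ).conductorNorm ℤ) (NumberField.discr K))
      (ι : K →+* ℂ) (P : ((⟨0, 1, 1, -12, 2⟩ : WeierstrassCurve ℚ).baseChange K).toAffine.Point) (j : K →ₐ[ℚ] ℚ_[2]),
      Zhai2021.IsOptimalDatum (⟨0, 1, 1, -12, 2⟩ : WeierstrassCurve ℚ) Dt ∧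
        WeierstrassCurve.Affine.Point.map ι.toRatAlgHom P = heegnerPointComplex Dt H ∧
          AssumptionStar (⟨0, 1, 1, -12, 2⟩ : WeierstrassCurve ℚ) Dt K P j

/-- **Kriz–Li 2019, §6 Table 1, row `141d1`** (`141d1 | d_K = -23 | c₂(E) = 1 | ★ ✓`; Example 6.2): for every imaginary quadratic field `K` of discriminant
`-23`, the optimal curve `141d1` on its (globally minimal) model `[0,-1,1,-1,0]` (`y² + y = x³ − x² − x`; `Δ = 3·47`, `N = 3·47`) admits an OPTIMAL modular
parametrisation datum `Dt` at level `N(E)`, a Heegner datum `H` of discriminant `d_K` and level `N(E)`, an embedding `ι : K → ℂ`, a point `P ∈ E(K)` mapping to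
`heegnerPointComplex Dt H`, and `j : K → ℚ₂` with `AssumptionStar E Dt K P j`.  Statement only; TABLE entry; no `_holds` expected.
[cite: KrizLi2019, §6 Table 1 (row 141d1) and Example 6.2 (FMS 7 (2019) e15, chunk p0017 L21; arXiv:1606.03172v3 Congruence.tex ll. 965, 983)] -/
def table1_row141d1 : Prop :=
  ∀ [(⟨0, -1, 1, -1, 0⟩ : WeierstrassCurve ℚ).IsGloballyMinimal]
    (K : Type) [Field K] [NumberField K], IsImaginaryQuadratic K → NumberField.discr K = -23 →
    ∃ (_ : NeZero ((⟨0, -1, 1, -1, 0⟩ : WeierstrassCurve ℚ).conductorNorm ℤ))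
      (Dt : ModularParametrizationData (⟨0, -1, 1, -1, 0⟩ : WeierstrassCurve ℚ) ((⟨0, -1, 1, -1, 0⟩ : WeierstrassCurve ℚ).conductorNorm ℤ))
      (H : HeegnerDatum ((⟨0, -1, 1, -1, 0⟩ : WeierstrassCurve ℚ).conductorNorm ℤ) (NumberField.discr K))
      (ι : K →+* ℂ) (P : ((⟨0, -1, 1, -1, 0⟩ : WeierstrassCurve ℚ).baseChange K).toAffine.Point) (j : K →ₐ[ℚ] ℚ_[2]),
      Zhai2021.IsOptimalDatum (⟨0, -1, 1, -1, 0⟩ : WeierstrassCurve ℚ) Dt ∧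
        WeierstrassCurve.Affine.Point.map ι.toRatAlgHom P = heegnerPointComplex Dt H ∧
          AssumptionStar (⟨0, -1, 1, -1, 0⟩ : WeierstrassCurve ℚ) Dt K P j

/-- **Kriz–Li 2019, §6 Table 1, row `155a1`** (`155a1 | d_K = -79 | c₂(E) = 1 | ★ ✓`; Example 6.2): for every imaginary quadratic field `K` of discriminant
`-79`, the optimal curve `155a1` on its (globally minimal) model `[0,-1,1,10,6]` (`y² + y = x³ − x² + 10x + 6`; `Δ = −5⁵·31`, `N = 5·31`) admits an OPTIMAL modular
parametrisation datum `Dt` at level `N(E)`, a Heegner datum `H` of discriminant `d_K` and level `N(E)`, an embedding `ι : K → ℂ`, a point `P ∈ E(K)` mapping to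
`heegnerPointComplex Dt H`, and `j : K → ℚ₂` with `AssumptionStar E Dt K P j`.  Statement only; TABLE entry; no `_holds` expected.
[cite: KrizLi2019, §6 Table 1 (row 155a1) and Example 6.2 (FMS 7 (2019) e15, chunk p0017 L21; arXiv:1606.03172v3 Congruence.tex ll. 965, 989)] -/
def table1_row155a1 : Prop :=
  ∀ [(⟨0, -1, 1, 10, 6⟩ : WeierstrassCurve ℚ).IsGloballyMinimal]
    (K : Type) [Field K] [NumberField K], IsImaginaryQuadratic K → NumberField.discr K = -79 →
    ∃ (_ : NeZero ((⟨0, -1, 1, 10, 6⟩ : WeierstrassCurve ℚ).conductorNorm ℤ))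
      (Dt : ModularParametrizationData (⟨0, -1, 1, 10, 6⟩ : WeierstrassCurve ℚ) ((⟨0, -1, 1, 10, 6⟩ : WeierstrassCurve ℚ).conductorNorm ℤ))
      (H : HeegnerDatum ((⟨0, -1, 1, 10, 6⟩ : WeierstrassCurve ℚ).conductorNorm ℤ) (NumberField.discr K))
      (ι : K →+* ℂ) (P : ((⟨0, -1, 1, 10, 6⟩ : WeierstrassCurve ℚ).baseChange K).toAffine.Point) (j : K →ₐ[ℚ] ℚ_[2]),
      Zhai2021.IsOptimalDatum (⟨0, -1, 1, 10, 6⟩ : WeierstrassCurve ℚ) Dt ∧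
        WeierstrassCurve.Affine.Point.map ι.toRatAlgHom P = heegnerPointComplex Dt H ∧
          AssumptionStar (⟨0, -1, 1, 10, 6⟩ : WeierstrassCurve ℚ) Dt K P j

/-- **Kriz–Li 2019, §6 Table 1, row `155c1`** (`155c1 | d_K = -79 | c₂(E) = 1 | ★ ✓`; Example 6.2): for every imaginary quadratic field `K` of discriminant
`-79`, the optimal curve `155c1` on its (globally minimal) model `[0,-1,1,-1,1]` (`y² + y = x³ − x² − x + 1`; `Δ = −5·31`, `N = 5·31`) admits an OPTIMAL modular
parametrisation datum `Dt` at level `N(E)`, a Heegner datum `H` of discriminant `d_K` and level `N(E)`, an embedding `ι : K → ℂ`, a point `P ∈ E(K)` mapping to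
`heegnerPointComplex Dt H`, and `j : K → ℚ₂` with `AssumptionStar E Dt K P j`.  Statement only; TABLE entry; no `_holds` expected.
[cite: KrizLi2019, §6 Table 1 (row 155c1) and Example 6.2 (FMS 7 (2019) e15, chunk p0017 L21; arXiv:1606.03172v3 Congruence.tex ll. 965, 990)] -/
def table1_row155c1 : Prop :=
  ∀ [(⟨0, -1, 1, -1, 1⟩ : WeierstrassCurve ℚ).IsGloballyMinimal]
    (K : Type) [Field K] [NumberField K], IsImaginaryQuadratic K → NumberField.discr K = -79 →
    ∃ (_ : NeZero ((⟨0, -1, 1, -1, 1⟩ : WeierstrassCurve ℚ).conductorNorm ℤ))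
      (Dt : ModularParametrizationData (⟨0, -1, 1, -1, 1⟩ : WeierstrassCurve ℚ) ((⟨0, -1, 1, -1, 1⟩ : WeierstrassCurve ℚ).conductorNorm ℤ))
      (H : HeegnerDatum ((⟨0, -1, 1, -1, 1⟩ : WeierstrassCurve ℚ).conductorNorm ℤ) (NumberField.discr K))
      (ι : K →+* ℂ) (P : ((⟨0, -1, 1, -1, 1⟩ : WeierstrassCurve ℚ).baseChange K).toAffine.Point) (j : K →ₐ[ℚ] ℚ_[2]),
      Zhai2021.IsOptimalDatum (⟨0, -1, 1, -1, 1⟩ : WeierstrassCurve ℚ) Dt ∧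
        WeierstrassCurve.Affine.Point.map ι.toRatAlgHom P = heegnerPointComplex Dt H ∧
          AssumptionStar (⟨0, -1, 1, -1, 1⟩ : WeierstrassCurve ℚ) Dt K P j

/-- **Kriz–Li 2019, §6 Table 1, row `219a1`** (`219a1 | d_K = -23 | c₂(E) = 1 | ★ ✓`; Example 6.2): for every imaginary quadratic field `K` of discriminant
`-23`, the optimal curve `219a1` on its (globally minimal) model `[0,-1,1,-6,8]` (`y² + y = x³ − x² − 6x + 8`; `Δ = −3·73`, `N = 3·73`) admits an OPTIMAL modular
parametrisation datum `Dt` at level `N(E)`, a Heegner datum `H` of discriminant `d_K` and level `N(E)`, an embedding `ι : K → ℂ`, a point `P ∈ E(K)` mapping to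
`heegnerPointComplex Dt H`, and `j : K → ℚ₂` with `AssumptionStar E Dt K P j`.  Statement only; TABLE entry; no `_holds` expected.
[cite: KrizLi2019, §6 Table 1 (row 219a1) and Example 6.2 (FMS 7 (2019) e15, chunk p0017 L21; arXiv:1606.03172v3 Congruence.tex ll. 965, 1007)] -/
def table1_row219a1 : Prop :=
  ∀ [(⟨0, -1, 1, -6, 8⟩ : WeierstrassCurve ℚ).IsGloballyMinimal]
    (K : Type) [Field K] [NumberField K], IsImaginaryQuadratic K → NumberField.discr K = -23 →
    ∃ (_ : NeZero ((⟨0, -1, 1, -6, 8⟩ : WeierstrassCurve ℚ).conductorNorm ℤ))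
      (Dt : ModularParametrizationData (⟨0, -1, 1, -6, 8⟩ : WeierstrassCurve ℚ) ((⟨0, -1, 1, -6, 8⟩ : WeierstrassCurve ℚ).conductorNorm ℤ))
      (H : HeegnerDatum ((⟨0, -1, 1, -6, 8⟩ : WeierstrassCurve ℚ).conductorNorm ℤ) (NumberField.discr K))
      (ι : K →+* ℂ) (P : ((⟨0, -1, 1, -6, 8⟩ : WeierstrassCurve ℚ).baseChange K).toAffine.Point) (j : K →ₐ[ℚ] ℚ_[2]),
      Zhai2021.IsOptimalDatum (⟨0, -1, 1, -6, 8⟩ : WeierstrassCurve ℚ) Dt ∧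
        WeierstrassCurve.Affine.Point.map ι.toRatAlgHom P = heegnerPointComplex Dt H ∧
          AssumptionStar (⟨0, -1, 1, -6, 8⟩ : WeierstrassCurve ℚ) Dt K P j

/-- **Kriz–Li 2019, §6 Table 1, row `219b1`** (`219b1 | d_K = -23 | c₂(E) = 1 | ★ ✓`; Example 6.2): for every imaginary quadratic field `K` of discriminant
`-23`, the optimal curve `219b1` on its (globally minimal) model `[0,1,1,3,2]` (`y² + y = x³ + x² + 3x + 2`; `Δ = −3³·73`, `N = 3·73`) admits an OPTIMAL modular
parametrisation datum `Dt` at level `N(E)`, a Heegner datum `H` of discriminant `d_K` and level `N(E)`, an embedding `ι : K → ℂ`, a point `P ∈ E(K)` mapping to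
`heegnerPointComplex Dt H`, and `j : K → ℚ₂` with `AssumptionStar E Dt K P j`.  Statement only; TABLE entry; no `_holds` expected.
[cite: KrizLi2019, §6 Table 1 (row 219b1) and Example 6.2 (FMS 7 (2019) e15, chunk p0017 L21; arXiv:1606.03172v3 Congruence.tex ll. 965, 1008)] -/
def table1_row219b1 : Prop :=
  ∀ [(⟨0, 1, 1, 3, 2⟩ : WeierstrassCurve ℚ).IsGloballyMinimal]
    (K : Type) [Field K] [NumberField K], IsImaginaryQuadratic K → NumberField.discr K = -23 →
    ∃ (_ : NeZero ((⟨0, 1, 1, 3, 2⟩ : WeierstrassCurve ℚ).conductorNorm ℤ))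
      (Dt : ModularParametrizationData (⟨0, 1, 1, 3, 2⟩ : WeierstrassCurve ℚ) ((⟨0, 1, 1, 3, 2⟩ : WeierstrassCurve ℚ).conductorNorm ℤ))
      (H : HeegnerDatum ((⟨0, 1, 1, 3, 2⟩ : WeierstrassCurve ℚ).conductorNorm ℤ) (NumberField.discr K))
      (ι : K →+* ℂ) (P : ((⟨0, 1, 1, 3, 2⟩ : WeierstrassCurve ℚ).baseChange K).toAffine.Point) (j : K →ₐ[ℚ] ℚ_[2]),
      Zhai2021.IsOptimalDatum (⟨0, 1, 1, 3, 2⟩ : WeierstrassCurve ℚ) Dt ∧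
        WeierstrassCurve.Affine.Point.map ι.toRatAlgHom P = heegnerPointComplex Dt H ∧
          AssumptionStar (⟨0, 1, 1, 3, 2⟩ : WeierstrassCurve ℚ) Dt K P j

end Literature.NumberTheory.EllipticCurves.KrizLi2019

end
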